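import Summits.QuantumFields.QCD.Theses.QuarksAsStableAction
import Literature.MathematicalPhysics.QuantumFieldTheory.QCDTimeReflection

/-!
# Crux-ideate sketches — `StableActionBridge` (stmt-QuantumFields-9737), ideator 2, round 1

First lemmas of the two idea cards `sylvester-defect-floor` and `twisted-trace-spine`
(statements only; every constant is an existing tree / Mathlib declaration).
-/

namespace Summit.QuantumFields.QCD.Cruxes.StableActionBridge.Ideator2

open scoped BigOperators Matrix ComplexConjugate ComplexOrder Classical
open MeasureTheory Filter
open Literature.MathematicalPhysics.QuantumLattice Literature.MathematicalPhysics.QuantumFieldTheory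
open Literature.Probability.LatticeModels

noncomputable section

local notation "𝔾" => Matrix.specialUnitaryGroup (Fin 3) ℂ

/-! ## Card `sylvester-defect-floor` -/

/-- **Sylvester defect identity** (the algebraic atom of the lever; provable now from
`Matrix.det_one_add_mul_comm`). For two gauge fields `U, U'` on the four-torus, the Wilson–Dirac
operators differ by a matrix `V = D − D'` supported on the DEFECT SET
`Z̄ = {x : some link touching x differs}`, so that for invertible `D'`
`det D = det D' · det(1 + χ V D'⁻¹ χ)` with `χ` the 0/1 diagonal projection onto `Z̄`:
only the block `χ D'⁻¹ χ` of the PATCHED field's propagator on the defect set enters. -/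
def SylvesterDefectIdentity : Prop :=
  ∀ (N L : ℕ) [NeZero L] (G : Type) [Group G] (ρ : G →* Matrix (Fin N) (Fin N) ℂ)
    (U U' : GaugeConfig 4 L G) (m r : ℝ),
    let D := wilsonDirac ρ U m r
    let D' := wilsonDirac ρ U' m r
    let χ : Matrix (TorusSite 4 L × Fin N × Fin 4) (TorusSite 4 L × Fin N × Fin 4) ℂ :=
      Matrix.diagonal fun p =>
        if (∃ μ : Fin 4, U (p.1, μ) ≠ U' (p.1, μ)) ∨
            (∃ μ : Fin 4, U (p.1 - Pi.single μ 1, μ) ≠ U' (p.1 - Pi.single μ 1, μ))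
        then 1 else 0
    IsUnit D'.det → D.det = D'.det * (1 + χ * (D - D') * D'⁻¹ * χ).det

/-- The all-directions antiperiodic `U(3)` lift of the trivial `SU(3)` field on the torus of side
`L` (links leaving the slice `x_μ = −1` carry `−1`), as in the route's `apDet`. -/
def apOne (L : ℕ) : GaugeConfig 4 L (Matrix.unitaryGroup (Fin 3) ℂ) :=
  fun e => if e.1 e.2 = -1 then -1 else 1

/-- **Free diagonal propagator bound** (the analytic atom: "4D integrability of the massless
lattice propagator at coincident points", uniformly in the volume). For the FREE `r = 1`
Wilson–Dirac operator with antiperiodic boundary conditions in all four directions and bare mass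
`m ∈ [0, 1]` (invertible: all antiperiodic momenta are non-zero), every entry of the coincident
block `D⁻¹(x, x)` is bounded by a constant independent of `L ≥ 2`, `m`, `x`. -/
def FreeDiagonalPropagatorBound : Prop :=
  ∃ C : ℝ, ∀ (L : ℕ) [NeZero L], 2 ≤ L → ∀ m : ℝ, 0 ≤ m → m ≤ 1 →
    ∀ (x : TorusSite 4 L) (a b : Fin 3) (i j : Fin 4),
      ‖(wilsonDirac (unitaryFundamentalRep (Fin 3) ℂ) (apOne L) m 1)⁻¹ (x, a, i) (x, b, j)‖ ≤ C

/-- **Stable majorant** (the `j = 0` anchor of the floor: a provable-now corollary of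
`WilsonQuarkStability`, using `N_bad · δ ≤ S_bad` and `S_good + S_bad = wilsonAction`): the
antiperiodic Wilson-quark determinant is dominated by the free one times `exp(K + c · S_W(U))`. -/
def StableMajorant : Prop :=
  ∃ ε c K : ℝ, 0 < ε ∧ ∃ L₀ : ℕ, ∀ (L : ℕ) [NeZero L], L₀ ≤ L →
    let apDet : GaugeConfig 4 L 𝔾 → ℝ → ℂ := fun U m =>
      fermionDet (wilsonDirac (unitaryFundamentalRep (Fin 3) ℂ)
        (fun e => if e.1 e.2 = -1
          then -(⟨(U e).1, Matrix.specialUnitaryGroup_le_unitaryGroup (U e).2⟩ :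
            Matrix.unitaryGroup (Fin 3) ℂ)
          else ⟨(U e).1, Matrix.specialUnitaryGroup_le_unitaryGroup (U e).2⟩) m 1)
    ∀ m : ℝ, |m| ≤ ε → ∀ U : GaugeConfig 4 L 𝔾,
      ‖apDet U m‖ ≤ Real.exp (K + c * wilsonAction (fundamentalRep (Fin 3)) U) * ‖apDet 1 m‖

/-- `WilsonQuarkStability → StableMajorant` (provable now; recorded as a statement). -/
def StableMajorantOfStability : Prop :=
  Summit.QuantumFields.QCD.Theses.QuarksAsStableAction.WilsonQuarkStability → StableMajorant

/-! ## Card `twisted-trace-spine` -/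

/-- **Twisted-trace domination** (first checkable statement of the spine; `= |Tr Γ𝕋^L| ≤ Tr 𝕋^L`
for Lüscher's positive transfer matrix, `Γ = (−1)^F`): on EVERY torus `(ℤ/L)⁴`, `L ≥ 2`, at every
`β ≥ 0` and all bare masses `m_f > −1` (`κ_f < 1/6`), the SIGNED `N_f`-flavour partition function
with the tree's time-PERIODIC `wilsonDirac` is bounded in modulus by the one with time-ANTIPERIODIC
quarks (`wilsonDiracAP`, the honest thermal trace), which is real. -/
def TwistedTraceDomination : Prop :=
  ∀ (Nf L : ℕ) [NeZero L], 2 ≤ L → ∀ β : ℝ, 0 ≤ β → ∀ m : Fin Nf → ℝ, (∀ f, -1 < m f) →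
    ‖∫ U, (∏ f, fermionDet (wilsonDirac (fundamentalRep (Fin 3)) U (m f) 1))
        ∂(wilsonMeasure (d := 4) (L := L) (fundamentalRep (Fin 3)) β)‖ ≤
      (∫ U, (∏ f, fermionDet (wilsonDiracAP (fundamentalRep (Fin 3)) U (m f) 1))
        ∂(wilsonMeasure (d := 4) (L := L) (fundamentalRep (Fin 3)) β)).re

/-- The finite-dimensional atom behind it: for a positive semidefinite `M` and a unitary `Γ`,
`|Tr(Γ M)| ≤ Tr M`. -/
def AbsTraceUnitaryMulPosSemidef : Prop :=
  ∀ (n : ℕ) (M Γ : Matrix (Fin n) (Fin n) ℂ), M.PosSemidef →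
    Γ ∈ Matrix.unitaryGroup (Fin n) ℂ → ‖(Γ * M).trace‖ ≤ (M.trace).re

/-- **Twisted vacuum dominance** (why a bare spectral gap is not enough on cubic tori): for a
positive semidefinite `T = P + R` with `P` a rank-one orthogonal projection (`P² = P = Pᴴ`,
`Tr P = 1`), `R` positive semidefinite with `P R = 0 = R P`, a unitary `Γ` commuting with `P` and
`R` and fixing the vacuum (`Γ P = P`), and any observable `X`, the twisted thermal expectation is
within `2‖X‖·r/(1 − r)` of the vacuum expectation, where `r = Tr Rⁿ` is the THERMAL ENTROPY SUM
(which must be small: a low-temperature pressure bound, not just `‖R‖ < 1`). Stated with the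
Frobenius-type entry bound `‖X i j‖ ≤ 1` to avoid operator-norm instances. -/
def TwistedVacuumDominance : Prop :=
  ∀ (d n : ℕ) (P R Γ X : Matrix (Fin d) (Fin d) ℂ), P.PosSemidef → R.PosSemidef →
    P * P = P → P.trace = 1 → P * R = 0 → R * P = 0 →
    Γ ∈ Matrix.unitaryGroup (Fin d) ℂ → Γ * P = P → Γ * R = R * Γ → (∀ i j, ‖X i j‖ ≤ 1) →
    (R ^ n).trace.re < 1 →
      ‖(Γ * (P + R) ^ n * X).trace / (Γ * (P + R) ^ n).trace - (P * X).trace‖ ≤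
        2 * d * (R ^ n).trace.re / (1 - (R ^ n).trace.re)

end

end Summit.QuantumFields.QCD.Cruxes.StableActionBridge.Ideator2
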